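import Mathlib
import Summits.Ventures.PercRepro2.Defs
import Summits.Ventures.PercRepro2.Independence
import Summits.Ventures.PercRepro2.CoinDefs
import Summits.Ventures.PercRepro2.CoinReverse
import Summits.Ventures.PercRepro2.CoinInduced
import Summits.Ventures.PercRepro2.CoinPendantDefs
import Summits.Ventures.PercRepro2.CoinTraceLevels
import Summits.Ventures.PercRepro2.CoinLsmCoreDefs
import Summits.Ventures.PercRepro2.CoinLsmCoreU
import Summits.Ventures.PercRepro2.CoinOrTailDefs

/-!
# An OR-tail with ANY NUMBER OF ENTRIES on one closed-in core: structure, the tail event and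
the level factorisation (blind cell PercRepro2, night-2 g10; proofs/NIGHT2-DARC.md §41)

`OrTailK arcs s U ent c a`: a closed-in core `U` of `s` (pairs at the root allowed), a set of
entries `ent ⊆ U`, and a tail `a ∉ U` entered ONLY by the single-arc coins `c r = {r → a}`,
`r ∈ ent` (`c` injective on `ent`).  The two-entry structure `OrTailU` (§37) is the case
`ent = {p, q}`.  The level of `U ∪ {a}` factorises through the level of `U` and the tail event
«`a ∈ W` iff some entry of `W` has its coin open» (`prob_coreLevel_eq`), whose probability is
`1 − tailWtK` / `tailWtK` with `tailWtK W = Π_{r ∈ ent} (1 − p(c r)·1[r ∈ W])`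
(`prob_tailEventK`).
-/

namespace Summit.Ventures.PercRepro2.Coin

open Classical

section OrTailKStructure

variable {V : Type*} {E : Type*} [DecidableEq V]

/-- An OR-tail with the entry set `ent` on one closed-in core: `U` closed-in below `s`,
`ent ⊆ U`, the tail `a` entered only by the coins `c r = {r → a}`, `r ∈ ent`. -/
structure OrTailK (arcs : E → Finset (V × V)) (s : V) (U : Finset V) (ent : Finset V)
    (c : V → E) (a : V) : Prop where
  ent_sub : ent ⊆ U
  s_notin : s ∉ U
  a_notin : a ∉ U
  a_ne_s : a ≠ s
  into_U : ∀ e, ∀ xy ∈ arcs e, xy.2 ∈ U → xy.1 ∈ U ∨ xy.1 = s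
  into_s : ∀ e, ∀ xy ∈ arcs e, xy.2 = s → xy.1 ∈ U ∨ xy.1 = s
  into_a : ∀ e, ∀ xy ∈ arcs e, xy.2 = a → ∃ r ∈ ent, e = c r ∧ xy.1 = r
  arcs_c : ∀ r ∈ ent, arcs (c r) = {(r, a)}
  c_inj : ∀ r ∈ ent, ∀ r' ∈ ent, c r = c r' → r = r'

variable {arcs : E → Finset (V × V)} {s : V} {U : Finset V} {ent : Finset V} {c : V → E} {a : V}

omit [DecidableEq V] in
/-- An entry is not the tail. -/
lemma OrTailK.ne_a (h : OrTailK arcs s U ent c a) {r : V} (hr : r ∈ ent) : r ≠ a :=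
  fun e => h.a_notin (e ▸ h.ent_sub hr)

/-- The whole core `U ∪ {a}` is a closed-in core (pairs at the root allowed). -/
lemma OrTailK.closedInCoreU (h : OrTailK arcs s U ent c a) :
    ClosedInCoreU arcs s (insert a U) where
  into_C := by
    intro e xy hxy hy
    simp only [Finset.mem_insert] at hy ⊢
    rcases hy with hy | hy
    · obtain ⟨r, hr, _, hx⟩ := h.into_a e xy hxy hy
      exact Or.inl (Or.inr (hx ▸ h.ent_sub hr))
    · rcases h.into_U e xy hxy hy with hx | hx
      · exact Or.inl (Or.inr hx)
      · exact Or.inr hx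
  into_s := by
    intro e xy hxy hy
    simp only [Finset.mem_insert]
    rcases h.into_s e xy hxy hy with hx | hx
    · exact Or.inl (Or.inr hx)
    · exact Or.inr hx
  s_notin := by
    simp only [Finset.mem_insert, not_or]
    exact ⟨h.a_ne_s.symm, h.s_notin⟩

omit [DecidableEq V] in
/-- An open arc into `a` is an open entry coin. -/
lemma OrTailK.openArc_a_iff (h : OrTailK arcs s U ent c a) {ω : Config E} {x : V} :
    OpenArc arcs ω x a ↔ ∃ r ∈ ent, x = r ∧ ω (c r) = true := by
  constructor
  · rintro ⟨e, he, hxa⟩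
    obtain ⟨r, hr, rfl, hx⟩ := h.into_a e (x, a) hxa rfl
    exact ⟨r, hr, hx, he⟩
  · rintro ⟨r, hr, rfl, he⟩
    exact ⟨c x, he, by rw [h.arcs_c x hr]; exact Finset.mem_singleton_self _⟩

omit [DecidableEq V] in
/-- **The tail is reached iff some entry is reached with its coin open.** -/
lemma OrTailK.reach_a_iff (h : OrTailK arcs s U ent c a) {ω : Config E} :
    Reach arcs ω s a ↔ ∃ r ∈ ent, Reach arcs ω s r ∧ ω (c r) = true := by
  constructor
  · intro hr
    rcases Relation.ReflTransGen.cases_tail hr with hsa | ⟨x, hsx, hxa⟩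
    · exact absurd hsa h.a_ne_s
    · obtain ⟨r, hr, rfl, he⟩ := h.openArc_a_iff.1 hxa
      exact ⟨x, hr, hsx, he⟩
  · rintro ⟨r, hr, hsr, he⟩
    exact reach_trans hsr (reach_of_openArc (h.openArc_a_iff.2 ⟨r, hr, rfl, he⟩))

/-- The tail event of the level `W`: `a ∈ W` iff some entry of `W` has its coin open. -/
def tailEventK (ent : Finset V) (c : V → E) (a : V) (W : Finset V) : Set (Config E) :=
  {ω | a ∈ W ↔ ∃ r ∈ ent, r ∈ W ∧ ω (c r) = true}

omit [DecidableEq V] in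
/-- Membership in the tail event. -/
lemma mem_tailEventK {W : Finset V} {ω : Config E} :
    ω ∈ tailEventK ent c a W ↔ (a ∈ W ↔ ∃ r ∈ ent, r ∈ W ∧ ω (c r) = true) := Iff.rfl

omit [DecidableEq V] in
/-- The tail event depends on the entry coins only. -/
lemma dependsOn_tailEventK (ent : Finset V) (c : V → E) (a : V) (W : Finset V) :
    DependsOn (· ∈ tailEventK ent c a W) (↑(ent.image c) : Set E) := by
  intro ω ω' hh
  simp only [tailEventK, Set.mem_setOf_eq, eq_iff_iff]
  have : ∀ r ∈ ent, ω (c r) = ω' (c r) := fun r hr =>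
    hh (c r) (by simpa using Finset.mem_image_of_mem c hr)
  constructor <;> intro h1 <;> refine h1.trans ?_ <;>
    exact exists_congr fun r => and_congr_right fun hr =>
      and_congr_right fun _ => by rw [this r hr]

/-- **The level factorisation (as events)**: the level of `U ∪ {a}` at `W` is the level of `U` at
`W ∩ U` intersected with the tail event. -/
theorem OrTailK.coreLevel_eq (h : OrTailK arcs s U ent c a) (W : Finset V) :
    coreLevel arcs s (insert a U) W = coreLevel arcs s U (W ∩ U) ∩ tailEventK ent c a W := by
  ext ω
  simp only [Set.mem_inter_iff, mem_coreLevel, mem_tailEventK, Finset.mem_inter,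
    Finset.mem_insert]
  constructor
  · intro hW
    refine ⟨fun z hz => ?_, ?_⟩
    · rw [and_iff_left hz]; exact hW z (Or.inr hz)
    · rw [hW a (Or.inl rfl), h.reach_a_iff]
      exact exists_congr fun r => and_congr_right fun hr =>
        and_congr_left fun _ => (hW r (Or.inr (h.ent_sub hr))).symm
  · rintro ⟨h1, h3⟩ z hz
    rcases hz with rfl | hz
    · rw [h3, h.reach_a_iff]
      exact exists_congr fun r => and_congr_right fun hr =>
        and_congr_left fun _ => by
          rw [← and_iff_left (a := r ∈ W) (h.ent_sub hr), h1 r (h.ent_sub hr)]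
    · rw [← and_iff_left (a := z ∈ W) hz]; exact h1 z hz

/-- The entry coins carry no arc into `U`. -/
lemma OrTailK.disjoint_tailCoins (h : OrTailK arcs s U ent c a) :
    Disjoint (coreCoins arcs U) (↑(ent.image c) : Set E) := by
  rw [Set.disjoint_right]
  intro e he hmem
  simp only [Finset.coe_image, Set.mem_image, Finset.mem_coe] at he
  obtain ⟨r, hr, rfl⟩ := he
  obtain ⟨xy, hxy, hy⟩ := mem_coreCoins.mp hmem
  rw [h.arcs_c r hr, Finset.mem_singleton] at hxy
  subst hxy
  exact h.a_notin hy

end OrTailKStructure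

section OrTailKProb

variable {V : Type*} {E : Type*} [DecidableEq V] [Fintype E] [DecidableEq E]
  {R : Type*} [CommRing R]
  {arcs : E → Finset (V × V)} {s : V} {U : Finset V} {ent : Finset V} {c : V → E} {a : V}

/-- **The level factorisation (probabilities)**: the level of `U` and the tail event are
independent. -/
theorem OrTailK.prob_coreLevel_eq (h : OrTailK arcs s U ent c a) (pr : E → R)
    (W : Finset V) :
    prob pr (coreLevel arcs s (insert a U) W) =
      prob pr (coreLevel arcs s U (W ∩ U)) * prob pr (tailEventK ent c a W) := by
  rw [h.coreLevel_eq W,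
    prob_inter_eq_mul_of_dependsOn pr h.disjoint_tailCoins
      (dependsOn_coreLevel_of_into h.into_U _) (dependsOn_tailEventK ent c a W)]

/-- The tail weight of a cluster: the probability that no entry of `W` has its coin open,
`Π_{r ∈ ent} (1 − p(c r)·1[r ∈ W])`. -/
def tailWtK (pr : E → R) (ent : Finset V) (c : V → E) (W : Finset V) : R :=
  ∏ r ∈ ent, (1 - pr (c r) * (if r ∈ W then 1 else 0))

/-- The event «every entry of `S` has its coin closed». -/
def allClosedK (c : V → E) (S : Finset V) : Set (Config E) :=
  {ω | ∀ r ∈ S, ω (c r) = false}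

omit [DecidableEq V] [Fintype E] in
/-- `allClosedK` depends on the coins of `S` only. -/
lemma dependsOn_allClosedK (c : V → E) (S : Finset V) :
    DependsOn (· ∈ allClosedK c S) (↑(S.image c) : Set E) := by
  intro ω ω' hh
  simp only [allClosedK, Set.mem_setOf_eq, eq_iff_iff]
  have : ∀ r ∈ S, ω (c r) = ω' (c r) := fun r hr =>
    hh (c r) (by simpa using Finset.mem_image_of_mem c hr)
  exact forall_congr' fun r => imp_congr_right fun hr => by rw [this r hr]

/-- **The product rule for the closed entry coins** (`c` injective on `S`). -/
theorem prob_allClosedK (pr : E → R) (c : V → E) (S : Finset V)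
    (hinj : ∀ r ∈ S, ∀ r' ∈ S, c r = c r' → r = r') :
    prob pr (allClosedK c S) = ∏ r ∈ S, (1 - pr (c r)) := by
  induction S using Finset.induction_on with
  | empty =>
    have : allClosedK c (∅ : Finset V) = Set.univ := by
      ext ω; simp [allClosedK]
    rw [this, prob_univ, Finset.prod_empty]
  | insert r S hr ih =>
    have hinj' : ∀ x ∈ S, ∀ y ∈ S, c x = c y → x = y := fun x hx y hy =>
      hinj x (Finset.mem_insert_of_mem hx) y (Finset.mem_insert_of_mem hy)
    have hsplit : allClosedK c (insert r S) = closedEdge (c r) ∩ allClosedK c S := by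
      ext ω
      simp only [allClosedK, closedEdge, Set.mem_inter_iff, Set.mem_setOf_eq,
        Finset.mem_insert, forall_eq_or_imp]
    have hdisj : Disjoint ({c r} : Set E) (↑(S.image c) : Set E) := by
      rw [Set.disjoint_left]
      intro e he hmem
      simp only [Set.mem_singleton_iff] at he
      subst he
      simp only [Finset.coe_image, Set.mem_image, Finset.mem_coe] at hmem
      obtain ⟨r', hr', hc⟩ := hmem
      have : r' = r := hinj r' (Finset.mem_insert_of_mem hr') r (Finset.mem_insert_self _ _) hc
      exact hr (this ▸ hr')
    rw [hsplit, prob_inter_eq_mul_of_dependsOn pr hdisj (dependsOn_closedEdge (c r))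
      (dependsOn_allClosedK c S), prob_closedEdge, ih hinj', Finset.prod_insert hr]

/-- **The tail factor**: `P(tail event of W) = 1 − tailWtK W` if `a ∈ W`, `tailWtK W`
otherwise. -/
theorem OrTailK.prob_tailEventK (h : OrTailK arcs s U ent c a) (pr : E → R) (W : Finset V) :
    prob pr (tailEventK ent c a W) =
      if a ∈ W then 1 - tailWtK pr ent c W else tailWtK pr ent c W := by
  set S := ent.filter (· ∈ W) with hS
  have hinj : ∀ r ∈ S, ∀ r' ∈ S, c r = c r' → r = r' := fun r hr r' hr' =>
    h.c_inj r (Finset.mem_filter.1 hr).1 r' (Finset.mem_filter.1 hr').1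
  have hprod : ∏ r ∈ S, (1 - pr (c r)) = tailWtK pr ent c W := by
    simp only [tailWtK, hS, Finset.prod_filter]
    refine Finset.prod_congr rfl fun r _ => ?_
    split_ifs <;> simp
  by_cases ha : a ∈ W
  · have hT : tailEventK ent c a W = (allClosedK c S)ᶜ := by
      ext ω
      simp only [tailEventK, allClosedK, Set.mem_setOf_eq, Set.mem_compl_iff, ha, true_iff,
        hS, Finset.mem_filter, not_forall, Bool.not_eq_false]
      constructor
      · rintro ⟨r, hr, hrW, he⟩; exact ⟨r, ⟨hr, hrW⟩, he⟩
      · rintro ⟨r, ⟨hr, hrW⟩, he⟩; exact ⟨r, hr, hrW, he⟩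
    rw [if_pos ha, hT, prob_compl, prob_allClosedK pr c S hinj, hprod]
  · have hT : tailEventK ent c a W = allClosedK c S := by
      ext ω
      simp only [tailEventK, allClosedK, Set.mem_setOf_eq, ha, false_iff, hS,
        Finset.mem_filter, not_exists, not_and, Bool.not_eq_true]
      constructor
      · intro h1 r ⟨hr, hrW⟩; exact h1 r hr hrW
      · intro h1 r hr hrW; exact h1 r ⟨hr, hrW⟩
    rw [if_neg ha, hT, prob_allClosedK pr c S hinj, hprod]

end OrTailKProb

end Summit.Ventures.PercRepro2.Coin
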